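import Summits.CriticalPhenomena.PercolationContinuityZ3.Theorems.Transplant.FKConnectivityAllQAntipodalQfree
import Summits.CriticalPhenomena.PercolationContinuityZ3.Theorems.Transplant.FKConnectivityAllQAntipodalAnd3Triangle
import HarnessLib

/-!
# Connectivity correlation inequalities for `φ_{w,q}`, every `q > 0` — file 46b: the `q`-FREE (level) form of `C_∞` for the AND / OR of the
# three edges of a TRIANGLE — the first `|supp f| = 3` instance of Conjecture C_∞⁺

Support file (`--supports stmt-CriticalPhenomena-4575`), FK sub-lane `prim-bschramm-fk-2` (gen 21); builds on p205010 (kernel theorem,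
internal audit signed; external expert review pending).  No definitions, no named facts, no sorries; standard axioms.

Gen 17's reduction `FK.apPsi_and3_triangle_eq` (`…And3Triangle.lean`: for a triangle `x = st, y = tv, z = sv` the antipodal form of
`1_x 1_y 1_z` over `H ∪ {z}` equals that of `1_x 1_y` over `H`) holds configuration by configuration WITH THE SAME CLUSTER LEVEL — the third
edge is redundant for the cluster count on the side that holds the other two and absent on the other side.  Hence it holds for EVERY level
weight `w` (`FK.apPsiW_and3_triangle_eq`), and gen 21's `q`-free level-2 theorem (`FK.apPsiW_level2_nonpos_of_isTTSP`, file 46) gives: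
* **`FK.apPsiW_and3_triangle_nonpos_of_isTTSP`** — `E` TTSP between `s, t`, `x = st ∉ E`, `y = tv ∈ E`, `z = sv ∉ E ∪ {x}`, `w` antitone, `g`
  increasing on the subsets of `E ∪ {x}` reading none of `x, y, z` ⟹ `∑_{γ ⊆ E ∪ {x,z}} w(k(γ)+k(γᶜ)) (1_{xyz⊆γ} − 1_{xyz⊆γᶜ})(g γ − g γᶜ) ≤ 0`;
* **`FK.apPsi_levels_le_and3_triangle_nonpos_of_isTTSP`** — the partial sums `∑_{level ≤ J}` are `≤ 0` for every `J`: the AND-drift of a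
  triangle satisfies gen 17's Conjecture AND⁺ (`a_S/(q−1)` has nonnegative coefficients), i.e. Conjecture C_∞⁺ (memo FROM-fk-2-g21, FK-Q2 §30)
  for `f = ω_x ω_y ω_z` on a triangle; `FK.apPsi_levels_le_or3_triangle_nonpos_of_isTTSP` — the same for `ω_x ∨ ω_y ∨ ω_z`.
[cite: Grimmett2006, §1.4 eq. (1.20) (p. 15); §3.8 Thm. (3.90) (pp. 61–62); §3.9 (pp. 63–64)] [cite: Wagner2006, Thm. 5.8(d), §5.3]
-/

noncomputable section

namespace Summit.CriticalPhenomena.PercolationContinuityZ3.Theorems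

namespace FK

open SimpleGraph Literature.Probability.LatticeModels Literature.Probability.Percolation
open scoped Classical

variable {V : Type*} [Fintype V] {s t v : V}

/-- **The triangle reduces to the path, for every level weight.**  For `z = sv ∉ H` and `g` not reading `z`:
`∑_{γ ⊆ H ∪ {z}} w(k(γ)+k(γᶜ)) (1_{st,tv,sv ⊆ γ} − 1_{… ⊆ γᶜ})(g γ − g γᶜ) = ∑_{γ ⊆ H} w(k(γ)+k(γᶜ)) (1_{st,tv ⊆ γ} − 1_{… ⊆ γᶜ})(g γ − g γᶜ)`
(`s ≠ t`, `t ≠ v`): gen 17's `FK.apPsi_and3_triangle_eq` with `q^ℓ` replaced by `w(ℓ)`. [cite: Grimmett2006, §1.4 eq. (1.20) (p. 15)] -/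
theorem apPsiW_and3_triangle_eq (w : ℕ → ℝ) {H : Finset (Sym2 V)} (hst : s ≠ t) (htv : t ≠ v) (hz : s(s, v) ∉ H)
    {g : Finset (Sym2 V) → ℝ} (hg : ∀ A : Finset (Sym2 V), g (insert s(s, v) A) = g A) :
    ∑ γ ∈ (insert s(s, v) H).powerset, w (apExp (insert s(s, v) H) γ) *
        (((if s(s, t) ∈ γ ∧ s(t, v) ∈ γ ∧ s(s, v) ∈ γ then (1 : ℝ) else 0) -
            (if s(s, t) ∈ insert s(s, v) H \ γ ∧ s(t, v) ∈ insert s(s, v) H \ γ ∧ s(s, v) ∈ insert s(s, v) H \ γ then 1 else 0)) *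
          (g γ - g (insert s(s, v) H \ γ))) =
      ∑ γ ∈ H.powerset, w (apExp H γ) *
        (((if s(s, t) ∈ γ ∧ s(t, v) ∈ γ then (1 : ℝ) else 0) - (if s(s, t) ∈ H \ γ ∧ s(t, v) ∈ H \ γ then 1 else 0)) *
          (g γ - g (H \ γ))) := by
  rw [Finset.sum_powerset_insert hz, ← Finset.sum_add_distrib]
  refine Finset.sum_congr rfl fun γ hγ => ?_
  have hγH : γ ⊆ H := Finset.mem_powerset.1 hγ
  have hzγ : s(s, v) ∉ γ := fun h => hz (hγH h)
  have hzc : s(s, v) ∉ H \ γ := fun h => hz (Finset.sdiff_subset h)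
  have e1 : insert s(s, v) H \ γ = insert s(s, v) (H \ γ) := Finset.insert_sdiff_of_notMem H hzγ
  have e2 : insert s(s, v) H \ insert s(s, v) γ = H \ γ := by
    rw [Finset.insert_sdiff_insert, Finset.sdiff_insert_of_notMem hz]
  rw [e1, e2]
  simp only [hzγ, hzc, Finset.mem_insert_self, and_true, and_false, if_false, hg]
  have m1 : ∀ X : Finset (Sym2 V), (s(s, t) ∈ insert s(s, v) X ↔ s(s, t) ∈ X) := fun X => by
    rw [Finset.mem_insert, or_iff_right]
    intro h
    have := Sym2.eq_iff.1 h
    rcases this with ⟨-, h2⟩ | ⟨h1, h2⟩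
    · exact htv h2
    · exact htv (h2 ▸ h1.symm ▸ rfl)
  have m2 : ∀ X : Finset (Sym2 V), (s(t, v) ∈ insert s(s, v) X ↔ s(t, v) ∈ X) := fun X => by
    rw [Finset.mem_insert, or_iff_right]
    intro h
    have := Sym2.eq_iff.1 h
    rcases this with ⟨h1, -⟩ | ⟨h1, h2⟩
    · exact hst h1.symm
    · exact hst (h2 ▸ h1 ▸ rfl)
  simp only [m1, m2]
  by_cases a1 : s(s, t) ∈ γ ∧ s(t, v) ∈ γ
  · have k1 : apExp (insert s(s, v) H) (insert s(s, v) γ) = apExp H γ := by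
      unfold apExp
      rw [e2, clusterCount_insert_of_reachable γ (reachable_of_two_edges hst htv a1.1 a1.2)]
    by_cases a2 : s(s, t) ∈ H \ γ ∧ s(t, v) ∈ H \ γ
    · exact absurd a1.1 (Finset.mem_sdiff.1 a2.1).2
    · rw [k1]; simp only [a1, a2, and_self, if_true, if_false]; ring
  · by_cases a2 : s(s, t) ∈ H \ γ ∧ s(t, v) ∈ H \ γ
    · have k2 : apExp (insert s(s, v) H) γ = apExp H γ := by
        unfold apExp
        rw [e1, clusterCount_insert_of_reachable (H \ γ) (reachable_of_two_edges hst htv a2.1 a2.2)]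
      rw [k2]; simp only [a1, a2, and_self, if_true, if_false]; ring
    · simp only [a1, a2, if_false]; ring

/-- **`q`-free `C_∞` for `and₃` on a triangle.**  `E` TTSP between `s, t`, `x = st ∉ E`, `y = tv ∈ E`, `z = sv ∉ E ∪ {x}`, `w` antitone,
`g` increasing on the subsets of `E ∪ {x}` reading none of `x, y, z` ⟹ the weighted antipodal form of `1_x 1_y 1_z` over `E ∪ {x, z}`
against `g` is `≤ 0`.  Proof: `FK.apPsiW_and3_triangle_eq` and gen 21's `FK.apPsiW_level2_nonpos_of_isTTSP` for `f = 1_x 1_y`.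
[cite: Grimmett2006, §3.8 Thm. (3.90) (pp. 61–62); §3.9 (pp. 63–64)] [cite: Wagner2006, Thm. 5.8(d), §5.3] -/
theorem apPsiW_and3_triangle_nonpos_of_isTTSP {E : Finset (Sym2 V)} (hE : IsTTSP E s t)
    (hx : s(s, t) ∉ E) (hy : s(t, v) ∈ E) (hz : s(s, v) ∉ insert s(s, t) E) {w : ℕ → ℝ} (hw : ∀ n : ℕ, w (n + 1) ≤ w n)
    {g : Finset (Sym2 V) → ℝ} (hgx : ∀ A : Finset (Sym2 V), g (insert s(s, t) A) = g A)
    (hgy : ∀ A : Finset (Sym2 V), g (insert s(t, v) A) = g A) (hgz : ∀ A : Finset (Sym2 V), g (insert s(s, v) A) = g A)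
    (hmono : ∀ ⦃A B : Finset (Sym2 V)⦄, A ⊆ B → B ⊆ insert s(s, t) E → g A ≤ g B) :
    ∑ γ ∈ (insert s(s, v) (insert s(s, t) E)).powerset, w (apExp (insert s(s, v) (insert s(s, t) E)) γ) *
        (((if s(s, t) ∈ γ ∧ s(t, v) ∈ γ ∧ s(s, v) ∈ γ then (1 : ℝ) else 0) -
            (if s(s, t) ∈ insert s(s, v) (insert s(s, t) E) \ γ ∧ s(t, v) ∈ insert s(s, v) (insert s(s, t) E) \ γ ∧
                s(s, v) ∈ insert s(s, v) (insert s(s, t) E) \ γ then 1 else 0)) *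
          (g γ - g (insert s(s, v) (insert s(s, t) E) \ γ))) ≤ 0 := by
  have htv : t ≠ v := fun h => hE.not_isDiag hy (Sym2.mk_isDiag_iff.2 h)
  rw [apPsiW_and3_triangle_eq w hE.ne htv hz hgz]
  have hxy : s(s, t) ≠ s(t, v) := fun h => hx (h ▸ hy)
  refine apPsiW_level2_nonpos_of_isTTSP hE hx (M := insert s(s, t) E) le_rfl (Finset.mem_insert_self _ _)
    (Finset.mem_insert_of_mem hy) hw (f := fun A => if s(s, t) ∈ A ∧ s(t, v) ∈ A then (1 : ℝ) else 0)
    (fun e he A => ?_) (fun A B hAB _ => ?_) hgx hgy hmono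
  · have hex : s(s, t) ≠ e := fun h => he (h ▸ by simp)
    have hey : s(t, v) ≠ e := fun h => he (h ▸ by simp)
    simp only [Finset.mem_insert, hex, hey, false_or]
  · by_cases h : s(s, t) ∈ A ∧ s(t, v) ∈ A
    · rw [if_pos h, if_pos ⟨hAB h.1, hAB h.2⟩]
    · rw [if_neg h]; split_ifs <;> norm_num

/-- **Conjecture AND⁺ for a triangle (partial sums).**  Under the hypotheses of `FK.apPsiW_and3_triangle_nonpos_of_isTTSP`, for every level
cut-off `J`: `∑_{γ ⊆ E ∪ {x,z} : k(γ)+k(γᶜ) ≤ J} (1_{xyz ⊆ γ} − 1_{xyz ⊆ γᶜ})(g γ − g γᶜ) ≤ 0` — the AND-drift polynomial `a_{xyz}(q)/(q−1)` of a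
triangle has nonnegative coefficients. [cite: Grimmett2006, §3.8 Thm. (3.90) (pp. 61–62); §3.9 (pp. 63–64)] [cite: Wagner2006, Thm. 5.8(d), §5.3] -/
theorem apPsi_levels_le_and3_triangle_nonpos_of_isTTSP {E : Finset (Sym2 V)} (hE : IsTTSP E s t)
    (hx : s(s, t) ∉ E) (hy : s(t, v) ∈ E) (hz : s(s, v) ∉ insert s(s, t) E) (J : ℕ)
    {g : Finset (Sym2 V) → ℝ} (hgx : ∀ A : Finset (Sym2 V), g (insert s(s, t) A) = g A)
    (hgy : ∀ A : Finset (Sym2 V), g (insert s(t, v) A) = g A) (hgz : ∀ A : Finset (Sym2 V), g (insert s(s, v) A) = g A)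
    (hmono : ∀ ⦃A B : Finset (Sym2 V)⦄, A ⊆ B → B ⊆ insert s(s, t) E → g A ≤ g B) :
    ∑ γ ∈ (insert s(s, v) (insert s(s, t) E)).powerset with apExp (insert s(s, v) (insert s(s, t) E)) γ ≤ J,
        ((if s(s, t) ∈ γ ∧ s(t, v) ∈ γ ∧ s(s, v) ∈ γ then (1 : ℝ) else 0) -
            (if s(s, t) ∈ insert s(s, v) (insert s(s, t) E) \ γ ∧ s(t, v) ∈ insert s(s, v) (insert s(s, t) E) \ γ ∧
                s(s, v) ∈ insert s(s, v) (insert s(s, t) E) \ γ then 1 else 0)) *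
          (g γ - g (insert s(s, v) (insert s(s, t) E) \ γ)) ≤ 0 := by
  have key := apPsiW_and3_triangle_nonpos_of_isTTSP hE hx hy hz (w := fun n => if n ≤ J then (1 : ℝ) else 0)
    (fun n => by
      split_ifs with h1 h2 h2
      · exact le_rfl
      · exact absurd ((Nat.le_succ n).trans h1) h2
      · exact zero_le_one
      · exact le_rfl) hgx hgy hgz hmono
  rw [Finset.sum_filter]
  refine le_of_eq_of_le (Finset.sum_congr rfl fun γ _ => ?_) key
  split_ifs <;> ring

/-- **… and for `or₃` on a triangle**: the odd increments of `1_x ∨ 1_y ∨ 1_z` and of `1_x 1_y 1_z` coincide termwise.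
[cite: Grimmett2006, §3.9 (pp. 63–64)] [cite: Wagner2006, Thm. 5.8(d), §5.3] -/
theorem apPsi_levels_le_or3_triangle_nonpos_of_isTTSP {E : Finset (Sym2 V)} (hE : IsTTSP E s t)
    (hx : s(s, t) ∉ E) (hy : s(t, v) ∈ E) (hz : s(s, v) ∉ insert s(s, t) E) (J : ℕ)
    {g : Finset (Sym2 V) → ℝ} (hgx : ∀ A : Finset (Sym2 V), g (insert s(s, t) A) = g A)
    (hgy : ∀ A : Finset (Sym2 V), g (insert s(t, v) A) = g A) (hgz : ∀ A : Finset (Sym2 V), g (insert s(s, v) A) = g A)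
    (hmono : ∀ ⦃A B : Finset (Sym2 V)⦄, A ⊆ B → B ⊆ insert s(s, t) E → g A ≤ g B) :
    ∑ γ ∈ (insert s(s, v) (insert s(s, t) E)).powerset with apExp (insert s(s, v) (insert s(s, t) E)) γ ≤ J,
        ((if s(s, t) ∈ γ ∨ s(t, v) ∈ γ ∨ s(s, v) ∈ γ then (1 : ℝ) else 0) -
            (if s(s, t) ∈ insert s(s, v) (insert s(s, t) E) \ γ ∨ s(t, v) ∈ insert s(s, v) (insert s(s, t) E) \ γ ∨
                s(s, v) ∈ insert s(s, v) (insert s(s, t) E) \ γ then 1 else 0)) *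
          (g γ - g (insert s(s, v) (insert s(s, t) E) \ γ)) ≤ 0 := by
  have key := apPsi_levels_le_and3_triangle_nonpos_of_isTTSP hE hx hy hz J hgx hgy hgz hmono
  have hxH : s(s, t) ∈ insert s(s, v) (insert s(s, t) E) := Finset.mem_insert_of_mem (Finset.mem_insert_self _ _)
  have hyH : s(t, v) ∈ insert s(s, v) (insert s(s, t) E) := Finset.mem_insert_of_mem (Finset.mem_insert_of_mem hy)
  have hzH : s(s, v) ∈ insert s(s, v) (insert s(s, t) E) := Finset.mem_insert_self _ _
  refine le_of_eq_of_le (Finset.sum_congr rfl fun γ _ => ?_) key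
  set H := insert s(s, v) (insert s(s, t) E)
  have cx : s(s, t) ∈ H \ γ ↔ s(s, t) ∉ γ := by rw [Finset.mem_sdiff]; exact ⟨fun h => h.2, fun h => ⟨hxH, h⟩⟩
  have cy : s(t, v) ∈ H \ γ ↔ s(t, v) ∉ γ := by rw [Finset.mem_sdiff]; exact ⟨fun h => h.2, fun h => ⟨hyH, h⟩⟩
  have cz : s(s, v) ∈ H \ γ ↔ s(s, v) ∉ γ := by rw [Finset.mem_sdiff]; exact ⟨fun h => h.2, fun h => ⟨hzH, h⟩⟩
  simp only [cx, cy, cz]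
  by_cases a : s(s, t) ∈ γ <;> by_cases b : s(t, v) ∈ γ <;> by_cases c : s(s, v) ∈ γ <;>
  simp only [a, b, c, and_true, and_false, or_true, or_false, if_true, if_false,
    not_true_eq_false, not_false_eq_true, and_self, or_self] <;> ring

end FK

end Summit.CriticalPhenomena.PercolationContinuityZ3.Theorems

end
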